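import Mathlib
import Literature.NumberTheory.ModularForms.LogLambda
import Literature.Analysis.SpecialFunctions.JacobiThetaAGM
import Literature.NumberTheory.EllipticCurves.ModularCurveKleinJ
import HarnessLib

/-!
# The level-`2` forms `𝓔 = (U + W)/2`, `Δ₂ = UV²W/256` and the Fricke involution `W₂`

[topic NumberTheory/ModularForms]

Level-`2` analogues of `E₄`, `Δ` for the group `Γ₀(2)⁺ = ⟨T, W₂⟩` (`W₂ : τ ↦ −1/(2τ)`), built from
the Jacobi theta forms `U = θ₃⁴, V = θ₂⁴, W = θ₄⁴` of `JacobiThetaGammaTwo.lean` and the Landen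
duplication identities `θ₃(2τ)² = (θ₃²+θ₄²)/2`, `θ₂(2τ)² = (θ₃²−θ₄²)/2`, `θ₄(2τ)² = θ₃θ₄` of
`Analysis/SpecialFunctions/JacobiThetaAGM.lean`:

* `eisTwo τ := (U + W)/2 = (θ₃⁴ + θ₄⁴)/2` — classically the weight-2 Eisenstein series
  `2E₂(2τ) − E₂(τ) = 1 + 24∑ σ₁^{odd}(n)qⁿ` of `Γ₀(2)` — and `deltaTwo τ := UV²W/256`
  (classically `η(τ)⁸η(2τ)⁸`), with **`𝓔(τ+1) = 𝓔(τ)`, `𝓔(−1/(2τ)) = −2τ²𝓔(τ)`,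
  `Δ₂(τ+1) = Δ₂(τ)`, `Δ₂(−1/(2τ)) = 16τ⁸Δ₂(τ)`** (`eisTwo_fricke`, `deltaTwo_fricke`): the key input
  is `U(2τ) + V(2τ) = 𝓔(τ)` and `U(2τ)V(2τ)W(2τ)² = V²UW/16`;
* the zero locus: `𝓔 = 0 ↔ λ = 2` (`eisTwo_eq_zero_iff`), `𝓔 = 0 → E₆ = 0` (a factor of
  `E₆ = ½(U+V)(U+W)(W−V)`), hence **`𝓔(τ) ≠ 0` for `Im τ > 1/2`** (`eisTwo_ne_zero_of_im_gt`) and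
  `𝓔((−1+i)/2) = 0` (`eisTwo_cornerTwo`: `λ((−1+i)/2) = 2`);
* the weight-`4` meromorphic form **`fTwo := Δ₂/𝓔²`** with `f₂(τ+1) = f₂(τ)`,
  `f₂(−1/(2τ)) = 4τ⁴ f₂(τ)` (`fTwo_fricke`), the level-2 analogue of `Δ/E₄²` used for the CM value
  `G₂^{Γ₀(2)}((i−1)/2, i/√2)` of Zhou 2015, Remark 9.

## References
* H. Cohn, A. Kumar, S. D. Miller, D. Radchenko, M. Viazovska, Ann. of Math. 196 (2022), §2.1
  (`U, V, W`, `λ`). [cite: CohnEtAl2019, §2.1.2]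
* Y. Zhou, Ramanujan J. 38 (2015), Remark 9 (level `2`). [cite: Zhou2015, Remark 9]
-/

noncomputable section

open Complex hiding I
open UpperHalfPlane hiding I
open Filter Topology ModularForm EisensteinSeries Real
open scoped MatrixGroups ModularForm Manifold

namespace Literature.NumberTheory.ModularForms

open Literature.NumberTheory.EllipticCurves.JacobiThetaNull (theta2 theta3 theta4)
open Literature.NumberTheory.EllipticCurves.ModularForms (E₆_eq_zero_iff)
open Literature.Analysis.SpecialFunctions (theta3_two_mul_sq theta2_two_mul_sq theta4_two_mul_sq)

/-! ## The points `2τ` and `W₂τ = −1/(2τ)` -/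

/-- `2τ ∈ ℍ`. [folklore] -/
def twoMul (τ : ℍ) : ℍ := ⟨2 * (τ : ℂ), by simpa using τ.im_pos⟩

/-- Coordinate of `2τ`. [folklore] -/
@[simp] theorem coe_twoMul (τ : ℍ) : ((twoMul τ : ℍ) : ℂ) = 2 * (τ : ℂ) := rfl

/-- The Fricke involution `W₂ τ = −1/(2τ)`. [folklore] -/
def frickeTwo (τ : ℍ) : ℍ :=
  UpperHalfPlane.mk (-((twoMul τ : ℍ) : ℂ))⁻¹ (twoMul τ).im_inv_neg_coe_pos

/-- Coordinate of `W₂ τ`. [folklore] -/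
theorem coe_frickeTwo (τ : ℍ) : ((frickeTwo τ : ℍ) : ℂ) = -1 / (2 * (τ : ℂ)) := by
  rw [frickeTwo, coe_mk_neg_inv, coe_twoMul]

/-! ## Duplication on `ℍ` -/

/-- `U(2τ) = (θ₃² + θ₄²)²/4`. [folklore] -/
theorem thetaU_twoMul (τ : ℍ) : thetaU (twoMul τ) = (theta3 τ ^ 2 + theta4 τ ^ 2) ^ 2 / 4 := by
  rw [thetaU_apply, coe_twoMul, show (4 : ℕ) = 2 * 2 from rfl, pow_mul, theta3_two_mul_sq]; ring

/-- `V(2τ) = (θ₃² − θ₄²)²/4`. [folklore] -/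
theorem thetaV_twoMul (τ : ℍ) : thetaV (twoMul τ) = (theta3 τ ^ 2 - theta4 τ ^ 2) ^ 2 / 4 := by
  rw [thetaV_apply, coe_twoMul, show (4 : ℕ) = 2 * 2 from rfl, pow_mul, theta2_two_mul_sq]; ring

/-- `W(2τ) = θ₃²θ₄²`. [folklore] -/
theorem thetaW_twoMul (τ : ℍ) : thetaW (twoMul τ) = theta3 τ ^ 2 * theta4 τ ^ 2 := by
  rw [thetaW_apply, coe_twoMul, show (4 : ℕ) = 2 * 2 from rfl, pow_mul, theta4_two_mul_sq]; ring

/-! ## `𝓔` and `Δ₂` -/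

/-- **`𝓔(τ) := (U(τ) + W(τ))/2 = (θ₃⁴ + θ₄⁴)/2`** (`= 2E₂(2τ) − E₂(τ)`, the weight-2 Eisenstein
series of `Γ₀(2)`; here DEFINED through thetas). [folklore] -/
def eisTwo (τ : ℍ) : ℂ := (thetaU τ + thetaW τ) / 2

/-- **`Δ₂(τ) := U V² W/256`** (`= η(τ)⁸η(2τ)⁸`, the weight-8 cusp form of `Γ₀(2)`; here DEFINED
through thetas). [folklore] -/
def deltaTwo (τ : ℍ) : ℂ := thetaU τ * thetaV τ ^ 2 * thetaW τ / 256

/-- `U(2τ) + V(2τ) = 𝓔(τ)`. [folklore] -/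
theorem thetaU_add_thetaV_twoMul (τ : ℍ) : thetaU (twoMul τ) + thetaV (twoMul τ) = eisTwo τ := by
  rw [thetaU_twoMul, thetaV_twoMul, eisTwo, thetaU_apply, thetaW_apply]; ring

/-- `U(2τ) V(2τ) W(2τ)² = V² U W/16`. [folklore] -/
theorem thetaUVWW_twoMul (τ : ℍ) :
    thetaU (twoMul τ) * thetaV (twoMul τ) * thetaW (twoMul τ) ^ 2 =
      thetaV τ ^ 2 * thetaU τ * thetaW τ / 16 := by
  have hJ : thetaV τ = thetaU τ - thetaW τ := by rw [thetaU_apply_eq τ]; ring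
  rw [thetaU_twoMul, thetaV_twoMul, thetaW_twoMul, hJ, thetaU_apply, thetaW_apply]; ring

/-- `𝓔(τ + 1) = 𝓔(τ)`. [folklore] -/
theorem eisTwo_vadd_one (τ : ℍ) : eisTwo ((1 : ℝ) +ᵥ τ) = eisTwo τ := by
  rw [eisTwo, eisTwo, thetaU_vadd_one, thetaW_vadd_one]; ring

/-- `Δ₂(τ + 1) = Δ₂(τ)`. [folklore] -/
theorem deltaTwo_vadd_one (τ : ℍ) : deltaTwo ((1 : ℝ) +ᵥ τ) = deltaTwo τ := by
  rw [deltaTwo, deltaTwo, thetaU_vadd_one, thetaW_vadd_one, thetaV_vadd_one]; ring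

/-- **Fricke law of `𝓔`**: `𝓔(−1/(2τ)) = −2τ² 𝓔(τ)` (`𝓔|₂W₂ = −𝓔`). [folklore] -/
theorem eisTwo_fricke (τ : ℍ) : eisTwo (frickeTwo τ) = -2 * (τ : ℂ) ^ 2 * eisTwo τ := by
  rw [eisTwo, frickeTwo, thetaU_neg_inv, thetaW_neg_inv, ← thetaU_add_thetaV_twoMul, coe_twoMul]
  ring

/-- **Fricke law of `Δ₂`**: `Δ₂(−1/(2τ)) = 16τ⁸ Δ₂(τ)` (`Δ₂|₈W₂ = Δ₂`). [folklore] -/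
theorem deltaTwo_fricke (τ : ℍ) : deltaTwo (frickeTwo τ) = 16 * (τ : ℂ) ^ 8 * deltaTwo τ := by
  rw [deltaTwo, frickeTwo, thetaU_neg_inv, thetaV_neg_inv, thetaW_neg_inv, coe_twoMul]
  have h := thetaUVWW_twoMul τ
  rw [deltaTwo]
  linear_combination ((τ : ℂ) ^ 8) * h

/-! ## Zeros of `𝓔` -/

/-- `𝓔 = U(2 − λ)/2`. [folklore] -/
theorem eisTwo_eq (τ : ℍ) : eisTwo τ = thetaU τ * (2 - modularLambda τ) / 2 := by
  have hU := thetaU_ne_zero τ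
  have hJ : thetaW τ = thetaU τ - thetaV τ := by rw [thetaU_apply_eq τ]; ring
  rw [eisTwo, modularLambda, hJ]
  field_simp
  ring

/-- **`𝓔(τ) = 0 ↔ λ(τ) = 2`.** [folklore] -/
theorem eisTwo_eq_zero_iff (τ : ℍ) : eisTwo τ = 0 ↔ modularLambda τ = 2 := by
  rw [eisTwo_eq, div_eq_zero_iff, mul_eq_zero, sub_eq_zero]
  have hU := thetaU_ne_zero τ
  constructor
  · rintro ((h | h) | h)
    · exact absurd h hU
    · exact h.symm
    · norm_num at h
  · intro h; exact Or.inl (Or.inr h.symm)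

/-- `𝓔 = 0 → E₆ = 0` (`U + W` is a factor of `E₆ = ½(U+V)(U+W)(W−V)`). [folklore] -/
theorem E₆_eq_zero_of_eisTwo_eq_zero {τ : ℍ} (h : eisTwo τ = 0) : E₆ τ = 0 := by
  have h' : thetaU τ + thetaW τ = 0 := by
    rw [eisTwo, div_eq_zero_iff] at h
    exact h.resolve_right two_ne_zero
  rw [E₆_eq_theta, h']; ring

/-- `𝓔(i) ≠ 0` (`λ(i) = 1/2 ≠ 2`). [folklore] -/
theorem eisTwo_I_ne_zero : eisTwo UpperHalfPlane.I ≠ 0 := by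
  rw [Ne, eisTwo_eq_zero_iff, modularLambda_I]; norm_num

/-- `𝓔` is invariant under integer translations. [folklore] -/
theorem eisTwo_vadd_int (τ : ℍ) (n : ℤ) : eisTwo ((n : ℝ) +ᵥ τ) = eisTwo τ := by
  induction n using Int.induction_on with
  | zero => simp
  | succ k ih =>
      have : (((k : ℤ) + 1 : ℤ) : ℝ) +ᵥ τ = (1 : ℝ) +ᵥ (((k : ℤ) : ℝ) +ᵥ τ) := by
        rw [vadd_vadd]; congr 1; push_cast; ring
      rw [this, eisTwo_vadd_one, ih]
  | pred k ih =>
      have : ((-(k : ℤ) : ℤ) : ℝ) +ᵥ τ = (1 : ℝ) +ᵥ (((-(k : ℤ) - 1 : ℤ) : ℝ) +ᵥ τ) := by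
        rw [vadd_vadd]; congr 1; push_cast; ring
      rw [this, eisTwo_vadd_one] at ih
      exact ih

/-- An element of `SL₂(ℤ)` with bottom row of `ℓ²`-norm `< 2` moves `i` to a translate `i + n`.
[folklore] -/
theorem smul_I_eq_vadd_of_sq_add_sq_lt_two (γ : SL(2, ℤ)) (h : (γ 1 0) ^ 2 + (γ 1 1) ^ 2 < 2) :
    ∃ n : ℤ, γ • UpperHalfPlane.I = (n : ℝ) +ᵥ UpperHalfPlane.I := by
  have hdet : γ 0 0 * γ 1 1 - γ 0 1 * γ 1 0 = 1 := by
    have := Matrix.SpecialLinearGroup.det_coe γ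
    rw [Matrix.det_fin_two] at this; linarith
  have hc : γ 1 0 ≤ 1 := by nlinarith [sq_nonneg (γ 1 1)]
  have hc' : -1 ≤ γ 1 0 := by nlinarith [sq_nonneg (γ 1 1)]
  have hd : γ 1 1 ≤ 1 := by nlinarith [sq_nonneg (γ 1 0)]
  have hd' : -1 ≤ γ 1 1 := by nlinarith [sq_nonneg (γ 1 0)]
  have hcoe : ((γ • UpperHalfPlane.I : ℍ) : ℂ) =
      (((γ 0 0 : ℤ) : ℂ) * Complex.I + ((γ 0 1 : ℤ) : ℂ)) / (((γ 1 0 : ℤ) : ℂ) * Complex.I + ((γ 1 1 : ℤ) : ℂ)) := by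
    rw [UpperHalfPlane.coe_specialLinearGroup_apply, UpperHalfPlane.coe_I]; simp
  -- enumerate the bottom row
  have key : ∃ n : ℤ, ((γ • UpperHalfPlane.I : ℍ) : ℂ) = (n : ℂ) + Complex.I := by
    interval_cases h10 : γ 1 0 <;> interval_cases h11 : γ 1 1
    all_goals try norm_num at h
    all_goals try norm_num at hdet
    · -- (c, d) = (-1, 0): b = 1
      refine ⟨-γ 0 0, ?_⟩
      have hb : γ 0 1 = 1 := by linarith
      rw [hcoe, hb]; push_cast
      field_simp [Complex.I_ne_zero]; ring_nf; rw [Complex.I_sq]; ring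
    · -- (0, -1): a = -1
      refine ⟨-γ 0 1, ?_⟩
      have ha : γ 0 0 = -1 := by linarith
      rw [hcoe, ha]; push_cast; ring
    · -- (0, 1): a = 1
      refine ⟨γ 0 1, ?_⟩
      have ha : γ 0 0 = 1 := by linarith
      rw [hcoe, ha]; push_cast; ring
    · -- (1, 0): b = -1
      refine ⟨γ 0 0, ?_⟩
      have hb : γ 0 1 = -1 := by linarith
      rw [hcoe, hb]; push_cast
      field_simp [Complex.I_ne_zero]; ring_nf; rw [Complex.I_sq]; ring
  obtain ⟨n, hn⟩ := key
  refine ⟨n, UpperHalfPlane.ext ?_⟩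
  rw [hn, UpperHalfPlane.coe_vadd, UpperHalfPlane.coe_I]; push_cast; ring

/-- **`𝓔(τ) ≠ 0` for `Im τ > 1/2`**: a zero of `𝓔` is a zero of `E₆`, i.e. `γ•i`, of height
`1/(c² + d²)`, which exceeds `1/2` only for `γ•i = i + n`, where `𝓔 = 𝓔(i) ≠ 0`. [folklore] -/
theorem eisTwo_ne_zero_of_im_gt {τ : ℍ} (hτ : 1 / 2 < τ.im) : eisTwo τ ≠ 0 := by
  intro h0
  obtain ⟨γ, hγ⟩ := E₆_eq_zero_iff.mp (E₆_eq_zero_of_eisTwo_eq_zero h0)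
  have him : (γ • UpperHalfPlane.I).im = 1 / (((γ 1 0 : ℤ) : ℝ) ^ 2 + ((γ 1 1 : ℤ) : ℝ) ^ 2) := by
    rw [ModularGroup.im_smul_eq_div_normSq, UpperHalfPlane.I_im, ModularGroup.denom_apply,
      Complex.normSq_apply]
    congr 1
    simp
    ring
  rw [hγ] at him
  have hpos : 0 < ((γ 1 0 : ℤ) : ℝ) ^ 2 + ((γ 1 1 : ℤ) : ℝ) ^ 2 := by
    have := τ.im_pos; rw [him] at this; exact one_div_pos.mp this
  have hlt : ((γ 1 0 : ℤ) : ℝ) ^ 2 + ((γ 1 1 : ℤ) : ℝ) ^ 2 < 2 := by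
    rw [him, lt_one_div (by norm_num) hpos] at hτ
    norm_num at hτ; linarith
  have hlt' : (γ 1 0) ^ 2 + (γ 1 1) ^ 2 < 2 := by exact_mod_cast hlt
  obtain ⟨n, hn⟩ := smul_I_eq_vadd_of_sq_add_sq_lt_two γ hlt'
  rw [hn] at hγ
  rw [← hγ, eisTwo_vadd_int] at h0
  exact eisTwo_I_ne_zero h0

/-! ## The weight-4 meromorphic form `f₂ = Δ₂/𝓔²` -/

/-- **`f₂ := Δ₂/𝓔²`** (junk `0` at the zeros of `𝓔`). [folklore] -/
def fTwo (τ : ℍ) : ℂ := deltaTwo τ / eisTwo τ ^ 2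

/-- `f₂(τ + 1) = f₂(τ)`. [folklore] -/
theorem fTwo_vadd_one (τ : ℍ) : fTwo ((1 : ℝ) +ᵥ τ) = fTwo τ := by
  rw [fTwo, fTwo, deltaTwo_vadd_one, eisTwo_vadd_one]

/-- **`f₂(−1/(2τ)) = 4τ⁴ f₂(τ)`** (`f₂|₄W₂ = f₂`). [folklore] -/
theorem fTwo_fricke (τ : ℍ) : fTwo (frickeTwo τ) = 4 * (τ : ℂ) ^ 4 * fTwo τ := by
  rw [fTwo, fTwo, deltaTwo_fricke, eisTwo_fricke]
  rcases eq_or_ne (eisTwo τ) 0 with h | h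
  · simp [h]
  · have hτ : (τ : ℂ) ≠ 0 := τ.ne_zero
    field_simp
    ring

/-! ## Behaviour at `i∞` -/

/-- `𝓔(τ) → 1` as `Im τ → ∞`. [folklore] -/
theorem tendsto_eisTwo : Tendsto eisTwo atImInfty (𝓝 1) := by
  have := (tendsto_thetaU.add tendsto_thetaW).div_const 2
  rw [show ((1 : ℂ) + 1) / 2 = 1 by norm_num] at this
  exact this

/-- `Δ₂(τ) → 0` as `Im τ → ∞`. [folklore] -/
theorem tendsto_deltaTwo : Tendsto deltaTwo atImInfty (𝓝 0) := by
  have := ((tendsto_thetaU.mul (tendsto_thetaV.pow 2)).mul tendsto_thetaW).div_const 256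
  rw [show ((1 : ℂ) * 0 ^ 2 * 1) / 256 = 0 by norm_num] at this
  exact this

/-- `𝓔` is holomorphic. [folklore] -/
theorem mdifferentiable_eisTwo : MDiff eisTwo := by
  have h : eisTwo = (thetaU + thetaW) * fun _ : ℍ => (1 / 2 : ℂ) := by
    funext τ; simp [eisTwo, div_eq_mul_inv]
  rw [h]
  exact (mdifferentiable_thetaU.add mdifferentiable_thetaW).mul mdifferentiable_const

/-- `Δ₂` is holomorphic. [folklore] -/
theorem mdifferentiable_deltaTwo : MDiff deltaTwo := by
  have h : deltaTwo = thetaU * thetaV ^ 2 * thetaW * fun _ : ℍ => (1 / 256 : ℂ) := by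
    funext τ; simp [deltaTwo, div_eq_mul_inv]
  rw [h]
  exact ((mdifferentiable_thetaU.mul (mdifferentiable_thetaV.pow 2)).mul mdifferentiable_thetaW).mul
    mdifferentiable_const

end Literature.NumberTheory.ModularForms
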